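/-
Copyright (c) 2026. All rights reserved.
Released under Apache 2.0 license as described in the file LICENSE.
Authors: abc-iut cell, prover seat abc-iut-L4-t15 (gen 10).
-/
import Literature.IUT.HodgeTheaters.ProfiniteCompletionQuotients
import Literature.AnabelianGeometry.AbsoluteAnabelian.FreeProSigmaCompletionBridge
import HarnessLib

/-!
# Profinite completions: the open KERNEL of a finite quotient inside `Ŵ`, and the corestriction of `η` to a
# finite-index normal subgroup is a pro-`𝔓𝔯𝔦𝔪𝔢𝔰` completion (hence free pro-`𝔓𝔯𝔦𝔪𝔢𝔰` on free letters)

Classical profinite group theory (Ribes–Zalesskii, *Profinite Groups*, Prop. 3.2.2 / Lemma 3.2.6: the profinite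
topology of `W` induces on a finite-index subgroup its own full profinite topology), in the vocabulary of the
abc-iut tree: Mathlib's `profiniteCompletion W` with `η = toCompletion W` (abc-iut-L5-t1,
`DiscreteProfiniteConjugates.lean`; plumbing `ProfiniteCompletionQuotients.lean`), abc-iut-L3's
`IsProSigmaCompletion` ([SemiAnbd] Ex. 2.10 interface, `Coverticial.lean`) and abc-iut-L4's `IsFreeProOn`
([AbsTopI] Lem. 4.5 (i) vocabulary) [cite: MochizukiAbsTopI2012, Lemma 4.5 (i) p.54]
[cite: MochizukiSemiAnbd2006, Ex. 2.10 p.31].  PROOF-ONLY file (0 definitions, 0 named facts; cell abc-iut,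
seat abc-iut-L4-t15 gen 10; the plumbing of L5 row R47 «GEOMORIGIN-NV@PROFINITE», consumer
`PuncturedEllipticGeomOriginProfiniteModel.lean`):

* `exists_open_subgroup_of_finiteIndex` — a finite-index normal `M ⊴ W` gives an OPEN subgroup `K ≤ Ŵ` with
  `[Ŵ : K] = [W : M]` and `η⁻¹(K) = M` (the kernel of the continuous projection `Ŵ ↠ W/M`);
  `le_closure_image_of_open` — such a `K` lies in the closure of `η(M)` (density of `η(W)`).  (The CLOSURE
  formulation `cl η(M)` — open, of index `[W : M]`, `η⁻¹ = M` — is abc-iut-L5's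
  `ProfiniteCompletionFiniteIndexIso.lean` / `ProfiniteCompletionOpenSubgroups.lean`; the kernel form is what
  the consumer's interface fields want literally.)
* **`isProSigmaCompletion_codRestrict`** — for an injective `i : F ↪ W` whose image is normal of finite index
  and such a `K`, the corestriction `F → K`, `x ↦ η(i x)` IS a pro-`𝔓𝔯𝔦𝔪𝔢𝔰` completion: dense image; open
  normal subgroups of the compact `K` have finite index; a finite-index normal `N ⊴ F` is cut out by the open
  subgroup `K ∩ p⁻¹(i(N)·L/L)`, `p : Ŵ ↠ W/L`, `L = core_W(i(N))`.
* **`isFreeProOn_codRestrict`** — for `F = F_n` free on `n` letters, `K` is FREE pro-`𝔓𝔯𝔦𝔪𝔢𝔰` on the letters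
  `η(i(x_a))` (abc-iut-L4-t15's bridge `isFreeProOn_of_isProSigmaCompletion_lift`, p424814);
  `isFreeProOn_univ_of_prime` — free pro-`𝔓𝔯𝔦𝔪𝔢𝔰` ⇒ free pro-`Set.univ` (the two index sets test the same
  finite groups: only PRIME divisors of `|K|` are examined by `IsFreeProOn`).

Nothing here is disputed mathematics; no IUT statement is asserted; nothing bears on [IUTchIII] Cor. 3.12.
-/

noncomputable section

open CategoryTheory Topology ProfiniteGrp

namespace Literature.IUT.HodgeTheaters

namespace ProfiniteCompletion

open Literature.AnabelianGeometry.SemiGraphs.SemiGraphOfAnabelioids (IsProSigmaCompletion)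
open Literature.AnabelianGeometry.AbsoluteAnabelian

variable {W : Type} [Group W]

/-- **The open kernel of a finite quotient inside `Ŵ`.** For a finite-index normal subgroup `M ⊴ W`
there is an OPEN subgroup `K ≤ Ŵ` of index `[W : M]` with `η(w) ∈ K ↔ w ∈ M` for all `w ∈ W` (the kernel of
the continuous projection `Ŵ ↠ W/M`). [cite: RibesZalesskii2010, Prop 3.2.2 and Lemma 3.2.6] -/
theorem exists_open_subgroup_of_finiteIndex (M : Subgroup W) [M.Normal] [M.FiniteIndex] :
    ∃ K : Subgroup (profiniteCompletion W), IsOpen (K : Set (profiniteCompletion W)) ∧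
      K.index = M.index ∧ ∀ w : W, toCompletion W w ∈ K ↔ w ∈ M := by
  classical
  let N₀ : FiniteIndexNormalSubgroup W := FiniteIndexNormalSubgroup.ofSubgroup M
  let p : profiniteCompletion W →* (ProfiniteCompletion.diagram (GrpCat.of W)).obj N₀ :=
    MonoidHom.mk' (fun x : profiniteCompletion W => x.val N₀) fun _ _ => rfl
  haveI : DiscreteTopology ((ProfiniteCompletion.diagram (GrpCat.of W)).obj N₀) := ⟨rfl⟩
  have hpc : Continuous p := continuous_val N₀
  have hps : Function.Surjective p := val_surjective N₀
  refine ⟨p.ker, ?_, ?_, fun w => ?_⟩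
  · change IsOpen (p ⁻¹' {1})
    exact (isOpen_discrete _).preimage hpc
  · rw [Subgroup.index_ker, MonoidHom.range_eq_top.mpr hps, Subgroup.card_top]
    rfl
  · rw [MonoidHom.mem_ker]
    change ((toCompletion W w).val N₀ : W ⧸ N₀.toSubgroup) = 1 ↔ w ∈ M
    rw [toCompletion_val]
    exact QuotientGroup.eq_one_iff w

/-- An open subgroup `K ≤ Ŵ` with `η⁻¹(K) = M` is contained in the closure of `η(M)` (`η(W)` is dense).
[cite: RibesZalesskii2010, Lemma 3.2.6] -/
theorem le_closure_image_of_open {M : Subgroup W} {K : Subgroup (profiniteCompletion W)}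
    (hKo : IsOpen (K : Set (profiniteCompletion W))) (hK : ∀ w : W, toCompletion W w ∈ K ↔ w ∈ M) :
    (K : Set (profiniteCompletion W)) ⊆ closure (toCompletion W '' (M : Set W)) := by
  intro k hk
  rw [mem_closure_iff]
  intro U hU hkU
  have hd : DenseRange (toCompletion W) := ProfiniteGrp.ProfiniteCompletion.denseRange (GrpCat.of W)
  obtain ⟨w, hyU, hyK⟩ := hd.exists_mem_open (hU.inter hKo) ⟨k, hkU, hk⟩
  exact ⟨toCompletion W w, hyU, w, (hK w).1 hyK, rfl⟩

/-- **The corestriction of `η` to a finite-index normal subgroup is a pro-`𝔓𝔯𝔦𝔪𝔢𝔰` completion.**  Let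
`i : F ↪ W` be an injective homomorphism whose image `M` is normal of finite index, and `K ≤ Ŵ` an open
subgroup with `η⁻¹(K) = M`.  Then `F → K`, `x ↦ η(i x)` is a pro-`𝔓𝔯𝔦𝔪𝔢𝔰` completion: dense image, open
normal subgroups of `K` have finite index, and every finite-index normal `N ⊴ F` is cut out by an open
subgroup of `K` (through `Ŵ ↠ W / core_W(i(N))`). [cite: RibesZalesskii2010, Prop 3.2.2 and Lemma 3.2.6]
[cite: MochizukiSemiAnbd2006, Ex. 2.10 p.31] -/
theorem isProSigmaCompletion_codRestrict {F : Type} [Group F] (i : F →* W) (hi : Function.Injective i)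
    [i.range.Normal] [hfi : i.range.FiniteIndex]
    (K : Subgroup (profiniteCompletion W)) (hKo : IsOpen (K : Set (profiniteCompletion W)))
    (hK : ∀ w : W, toCompletion W w ∈ K ↔ w ∈ i.range)
    (hmem : ∀ x : F, (toCompletion W).comp i x ∈ K) :
    IsProSigmaCompletion {p : ℕ | p.Prime} (((toCompletion W).comp i).codRestrict K hmem) := by
  classical
  set j := ((toCompletion W).comp i).codRestrict K hmem with hj
  have hKc : IsClosed (K : Set (profiniteCompletion W)) := K.isClosed_of_isOpen hKo
  haveI : CompactSpace K := isCompact_iff_compactSpace.mp hKc.isCompact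
  refine ⟨?_, ?_, ?_⟩
  · -- dense image
    rw [Topology.IsInducing.subtypeVal.dense_iff]
    intro k
    have hsub := le_closure_image_of_open hKo hK k.2
    refine closure_mono ?_ hsub
    rintro _ ⟨w, hw, rfl⟩
    obtain ⟨x, rfl⟩ := hw
    exact ⟨j x, ⟨x, rfl⟩, rfl⟩
  · -- open normal subgroups of the compact group `K` have finite (hence 𝔓-integer) index
    intro N _ hN
    haveI : Finite (K ⧸ N) := Subgroup.quotient_finite_of_isOpen N hN
    exact ⟨Nat.pos_of_ne_zero Subgroup.index_ne_zero_of_finite, fun p hp _ => hp⟩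
  · -- a finite-index normal `N ⊴ F` is cut out by `Ŵ ↠ W / core(i(N))`
    intro N hN hσ
    haveI : N.FiniteIndex := ⟨hσ.1.ne'⟩
    haveI : (N.map i).FiniteIndex := by
      constructor
      rw [Subgroup.index_map, i.ker_eq_bot_iff.mpr hi, sup_bot_eq]
      exact mul_ne_zero Subgroup.FiniteIndex.index_ne_zero hfi.index_ne_zero
    let L : Subgroup W := (N.map i).normalCore
    haveI : L.Normal := Subgroup.normalCore_normal _
    haveI : L.FiniteIndex := inferInstance
    let N₁ : FiniteIndexNormalSubgroup W := FiniteIndexNormalSubgroup.ofSubgroup L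
    let p₁ : profiniteCompletion W →* (ProfiniteCompletion.diagram (GrpCat.of W)).obj N₁ :=
      MonoidHom.mk' (fun x : profiniteCompletion W => x.val N₁) fun _ _ => rfl
    haveI : DiscreteTopology ((ProfiniteCompletion.diagram (GrpCat.of W)).obj N₁) := ⟨rfl⟩
    have hp₁c : Continuous p₁ := continuous_val N₁
    have hp₁η : ∀ w : W, p₁ (toCompletion W w) = (QuotientGroup.mk w : W ⧸ L) := fun w => rfl
    let S : Subgroup (W ⧸ L) := (N.map i).map (QuotientGroup.mk' L)
    refine ⟨(S.comap p₁).comap K.subtype, ?_, ?_⟩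
    · have hSo : IsOpen ((p₁ : profiniteCompletion W → _) ⁻¹' (S : Set (W ⧸ L))) :=
        (@isOpen_discrete ((ProfiniteCompletion.diagram (GrpCat.of W)).obj N₁) _ _ (S : Set (W ⧸ L))).preimage hp₁c
      exact hSo.preimage continuous_subtype_val
    · ext x
      simp only [Subgroup.mem_comap, Subgroup.coe_subtype]
      change p₁ (toCompletion W (i x)) ∈ S ↔ x ∈ N
      rw [hp₁η]
      constructor
      · rintro ⟨_, ⟨n, hn, rfl⟩, h⟩
        change (QuotientGroup.mk (i n) : W ⧸ L) = QuotientGroup.mk (i x) at h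
        rw [QuotientGroup.eq] at h
        have hL : (i n)⁻¹ * i x ∈ N.map i := Subgroup.normalCore_le _ h
        rw [← map_inv, ← map_mul] at hL
        obtain ⟨m, hm, hmi⟩ := hL
        have : m = n⁻¹ * x := hi hmi
        subst this
        simpa using N.mul_mem hn hm
      · intro hx
        exact ⟨i x, ⟨x, hx, rfl⟩, rfl⟩

/-- **Free profinite on the letters**: with `F = F₂` free on two letters and `i`, `K` as above, the open
subgroup `K` is free pro-`𝔓𝔯𝔦𝔪𝔢𝔰` on `η(i(x₀)), η(i(x₁))` (abc-iut-L4-t15's bridge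
`isFreeProOn_of_isProSigmaCompletion_lift`). [cite: MochizukiAbsTopI2012, Lemma 4.5 (i) p.54] -/
theorem isFreeProOn_codRestrict {n : ℕ} (i : FreeGroup (Fin n) →* W) (hi : Function.Injective i)
    [i.range.Normal] [i.range.FiniteIndex]
    (K : Subgroup (profiniteCompletion W)) (hKo : IsOpen (K : Set (profiniteCompletion W)))
    (hK : ∀ w : W, toCompletion W w ∈ K ↔ w ∈ i.range)
    (hmem : ∀ x : FreeGroup (Fin n), (toCompletion W).comp i x ∈ K) :
    IsFreeProOn K {p : ℕ | p.Prime}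
      (fun a : Fin n => ((toCompletion W).comp i).codRestrict K hmem (FreeGroup.of a)) := by
  have hKc : IsClosed (K : Set (profiniteCompletion W)) := K.isClosed_of_isOpen hKo
  haveI : CompactSpace K := isCompact_iff_compactSpace.mp hKc.isCompact
  have hlift : FreeGroup.lift (fun a : Fin n => ((toCompletion W).comp i).codRestrict K hmem (FreeGroup.of a)) =
      ((toCompletion W).comp i).codRestrict K hmem := by
    ext a; simp
  have h := isProSigmaCompletion_codRestrict i hi K hKo hK hmem
  rw [← hlift] at h
  exact isFreeProOn_of_isProSigmaCompletion_lift h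


/-- `free pro-𝔓𝔯𝔦𝔪𝔢𝔰 ⇒ free pro-(Set.univ)`: the two index sets single out the same finite groups (only PRIME
divisors of `|K|` are tested), so the universal properties coincide. [cite: MochizukiAbsTopI2012, Lemma 4.5 (i) p.54] -/
theorem isFreeProOn_univ_of_prime {G : Type*} [Group G] [TopologicalSpace G] {n : ℕ} {gens : Fin n → G}
    (h : IsFreeProOn G {p : ℕ | p.Prime} gens) : IsFreeProOn G Set.univ gens :=
  ⟨⟨fun _ _ _ q _ _ => Set.mem_univ q⟩, fun K _ _ _ _ _ f => h.2 K (fun _ hq _ => hq) f⟩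

end ProfiniteCompletion

end Literature.IUT.HodgeTheaters

end
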